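import Literature.NumberTheory.GaloisRepresentations.ContinuousRep
import HarnessLib

/-!
# Twists of framed representations by continuous characters

Topic `NumberTheory/GaloisRepresentations`.  For a topological group `G`, a topological
commutative ring `A`, a framed continuous representation `ρ : G →ₜ* GL_n(A)`
(`Literature.NumberTheory.GaloisRepresentations.FramedRep`) and a continuous character
`χ : G →ₜ* Aˣ`, the **twist** `ρ ⊗ χ : g ↦ χ(g) · ρ(g)` is again a framed continuous representation
(`FramedRep.twist`), with `det (ρ ⊗ χ) = χⁿ · det ρ` (`det_twist_apply`), `(ρ ⊗ χ) ⊗ χ' = ρ ⊗ (χ'χ)`,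
`ρ ⊗ 1 = ρ`, and twisting commutes with a change of frame (`conj_twist`).  This is the operation
"twisting by a (quadratic) character" ubiquitous in the modularity literature (e.g.
Breuil–Conrad–Diamond–Taylor 2001, proof of Thm. 2.2.1: "up to equivalence and twisting by a
quadratic character"; Serre 1987, (2.2): `ρ ⊗ χ^{-α}`), absent so far from the tree for framed
representations (Mathlib has no `GL_n`-valued continuous representations at all).

## Main definitions and results

* `FramedRep.scalar n : Aˣ →ₜ* GL (Fin n) A` — the central embedding `a ↦ a · 1`.
* `FramedRep.twist ρ χ : FramedRep G A n` — `g ↦ scalar (χ g) * ρ g`; `coe_twist_apply`: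
  as a matrix this is `χ g • ρ g`.
* `FramedRep.det_twist_apply`, `FramedRep.twist_one`, `FramedRep.twist_twist`,
  `FramedRep.conj_twist`.

## References

* J.-P. Serre, *Sur les représentations modulaires de degré 2 de Gal(ℚ̄/ℚ)*, Duke Math. J. 54
  (1987), §2.2 (twists `ρ ⊗ χ^m`). [Serre1987Duke]
* C. Breuil, B. Conrad, F. Diamond, R. Taylor, J. Amer. Math. Soc. 14 (2001), §2.2. [BCDTJAMS2001]
-/

noncomputable section

namespace Literature.NumberTheory.GaloisRepresentations

universe u v

section Twist

variable {G : Type u} {A : Type v} [Group G] [TopologicalSpace G] [CommRing A] [TopologicalSpace A]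
  {n : ℕ}

namespace FramedRep

variable (A n) in
/-- **The scalar embedding `Aˣ → GL_n(A)`, `a ↦ a · 1`** (Mathlib `Units.map` of
`algebraMap A (Matrix (Fin n) (Fin n) A)`), a continuous homomorphism with central image.
[folklore] -/
def scalar : Aˣ →ₜ* GL (Fin n) A where
  toMonoidHom := Units.map (algebraMap A (Matrix (Fin n) (Fin n) A)).toMonoidHom
  continuous_toFun := by
    have hc : Continuous fun a : A ↦ algebraMap A (Matrix (Fin n) (Fin n) A) a := by
      have : (fun a : A ↦ algebraMap A (Matrix (Fin n) (Fin n) A) a) =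
          fun a : A ↦ Matrix.diagonal fun _ : Fin n ↦ a := by
        funext a
        rw [Matrix.algebraMap_eq_diagonal]
        rfl
      rw [this]
      exact (continuous_pi fun _ ↦ continuous_id).matrix_diagonal
    exact Continuous.units_map _ hc

/-- The scalar `a · 1` as a matrix. [folklore] -/
@[simp] lemma coe_scalar_apply (a : Aˣ) :
    ((scalar A n a : GL (Fin n) A) : Matrix (Fin n) (Fin n) A) =
      algebraMap A (Matrix (Fin n) (Fin n) A) a := rfl

/-- Scalars are central in `GL_n(A)`. [folklore] -/
theorem scalar_commute (a : Aˣ) (g : GL (Fin n) A) : Commute (scalar A n a) g := by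
  rw [Commute, SemiconjBy, Units.ext_iff, Units.val_mul, Units.val_mul, coe_scalar_apply]
  exact Algebra.commutes (a : A) (g : Matrix (Fin n) (Fin n) A)

/-- `scalar a * g = g * scalar a`. [folklore] -/
theorem scalar_mul_comm (a : Aˣ) (g : GL (Fin n) A) : scalar A n a * g = g * scalar A n a :=
  (scalar_commute a g).eq

variable [IsTopologicalRing A]

/-- **The twist `ρ ⊗ χ` of a framed representation by a continuous character**:
`g ↦ χ(g) · ρ(g)` (a homomorphism because scalars are central; continuous as a product of
continuous maps).  Serre 1987, (2.2); BCDT 2001, §2.2 ("twisting by a quadratic character").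
[cite: BCDTJAMS2001, §2.2 (proof of Thm. 2.2.1, p. 860)] -/
def twist (ρ : FramedRep G A n) (χ : G →ₜ* Aˣ) : FramedRep G A n where
  toMonoidHom :=
    { toFun := fun g ↦ scalar A n (χ g) * ρ g
      map_one' := by rw [map_one, map_one, map_one, one_mul]
      map_mul' := fun g h ↦ by
        rw [map_mul, map_mul, map_mul, mul_assoc, ← mul_assoc (scalar A n (χ h)),
          scalar_mul_comm (χ h) (ρ g)]
        group }
  continuous_toFun :=
    show Continuous fun g ↦ scalar A n (χ g) * ρ g from
    ((map_continuous (scalar A n)).comp (map_continuous χ)).mul (map_continuous ρ)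

/-- Unfolding lemma for `FramedRep.twist`. [folklore] -/
@[simp] lemma twist_apply (ρ : FramedRep G A n) (χ : G →ₜ* Aˣ) (g : G) :
    ρ.twist χ g = scalar A n (χ g) * ρ g := rfl

/-- `(ρ ⊗ χ)(g) = χ(g) • ρ(g)` as matrices. [folklore] -/
theorem coe_twist_apply (ρ : FramedRep G A n) (χ : G →ₜ* Aˣ) (g : G) :
    ((ρ.twist χ g : GL (Fin n) A) : Matrix (Fin n) (Fin n) A) =
      (χ g : A) • ((ρ g : GL (Fin n) A) : Matrix (Fin n) (Fin n) A) := by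
  rw [twist_apply, Units.val_mul, coe_scalar_apply, ← Algebra.smul_def]

/-- **`det (ρ ⊗ χ) = χⁿ · det ρ`.** [folklore] -/
theorem det_twist_apply (ρ : FramedRep G A n) (χ : G →ₜ* Aˣ) (g : G) :
    Matrix.GeneralLinearGroup.det (ρ.twist χ g) = χ g ^ n * Matrix.GeneralLinearGroup.det (ρ g) := by
  ext
  rw [Matrix.GeneralLinearGroup.val_det_apply, coe_twist_apply, Matrix.det_smul, Fintype.card_fin,
    Units.val_mul, Units.val_pow_eq_pow_val, Matrix.GeneralLinearGroup.val_det_apply]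

/-- Twisting by the trivial character does nothing. [folklore] -/
@[simp] theorem twist_one (ρ : FramedRep G A n) : ρ.twist 1 = ρ := by
  refine ContinuousMonoidHom.ext fun g ↦ ?_
  rw [twist_apply, ContinuousMonoidHom.coe_one, Pi.one_apply, map_one, one_mul]

/-- **Twists compose**: `(ρ ⊗ χ) ⊗ χ' = ρ ⊗ (χ'χ)`. [folklore] -/
theorem twist_twist (ρ : FramedRep G A n) (χ χ' : G →ₜ* Aˣ) :
    (ρ.twist χ).twist χ' = ρ.twist (χ' * χ) := by
  refine ContinuousMonoidHom.ext fun g ↦ ?_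
  rw [twist_apply, twist_apply, twist_apply, ContinuousMonoidHom.mul_apply, map_mul, mul_assoc]

/-- Twisting by `χ` and then by `χ⁻¹` recovers `ρ`. [folklore] -/
theorem twist_twist_inv (ρ : FramedRep G A n) (χ : G →ₜ* Aˣ) : (ρ.twist χ).twist χ⁻¹ = ρ := by
  rw [twist_twist, inv_mul_cancel, twist_one]

/-- **Twisting commutes with a change of frame**: `(ρ ⊗ χ)^P = ρ^P ⊗ χ` (scalars are central).
[folklore] -/
theorem conj_twist (ρ : FramedRep G A n) (χ : G →ₜ* Aˣ) (P : GL (Fin n) A) :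
    (ρ.twist χ).conj P = (ρ.conj P).twist χ := by
  refine ContinuousMonoidHom.ext fun g ↦ ?_
  rw [conj_apply, twist_apply, twist_apply, conj_apply, ← mul_assoc, ← scalar_mul_comm (χ g) P]
  group

/-- The value of a conjugated twist: `P (ρ ⊗ χ)(g) P⁻¹ = χ(g) · (P ρ(g) P⁻¹)`. [folklore] -/
theorem conj_twist_apply (ρ : FramedRep G A n) (χ : G →ₜ* Aˣ) (P : GL (Fin n) A) (g : G) :
    P * ρ.twist χ g * P⁻¹ = scalar A n (χ g) * (P * ρ g * P⁻¹) := by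
  have h := congrArg (fun σ : FramedRep G A n ↦ σ g) (conj_twist ρ χ P)
  simpa only [conj_apply, twist_apply] using h

/-- A character with values in `{±1}` acts through `±1`: if `χ(g) = -1` then
`(ρ ⊗ χ)(g) = -ρ(g)`. [folklore] -/
theorem twist_apply_of_eq_neg_one (ρ : FramedRep G A n) (χ : G →ₜ* Aˣ) {g : G} (h : χ g = -1) :
    ρ.twist χ g = -ρ g := by
  rw [twist_apply, h]
  have : scalar A n (-1) = -1 := by
    ext
    rw [coe_scalar_apply, Units.val_neg, Units.val_one, map_neg, map_one, Units.val_neg,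
      Units.val_one]
  rw [this, neg_one_mul]

/-- If `χ(g) = 1` then `(ρ ⊗ χ)(g) = ρ(g)`. [folklore] -/
theorem twist_apply_of_eq_one (ρ : FramedRep G A n) (χ : G →ₜ* Aˣ) {g : G} (h : χ g = 1) :
    ρ.twist χ g = ρ g := by
  rw [twist_apply, h, map_one, one_mul]

end FramedRep

end Twist

end Literature.NumberTheory.GaloisRepresentations

end
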